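import Summits.ValiantsHypothesis.ValiantsHypothesis.Theorems.GrenetZeonDualUnipotentThreeHalvesLongMassLedgerBorelClosure

/-!
# PART VIII/IX BY NAME (`LedgerUnipotent`: `LinEquivariant`, `windowCone_linAct`, ★★ `ledger_stable_of_unipotentEquivariant`, `relCert_stable_of_unipotentEquivariant`, ★★ `ledger_borel_of_equivariant`, ★★ `relCert_borel_of_equivariant`) — Theorems-side port of val-idea-28 g5's staged `…LongMassLedgerBorel.lean` (sha16 778689f35a337204, 681 l.; Parts VIII–IX of
# `Cruxes/DualUnipotentThreeHalves/InitialForm.lean` rev 14 @11411eb80f60; crit-7 V40 «CORRECT INSTRUMENT», V36 §B; desk val-lit #420 «port-3's next»)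

PORT NOTE.  Decl texts VERBATIM BY NAME, namespaces as staged (`…InitialForm.UnipotentClosure` / `.LedgerUnipotent`); the ONLY changes are the 400-line-cap
SPLIT into three chained modules `GrenetZeonDualUnipotentThreeHalvesLongMassLedgerBorel{Family, Closure, ∅}.lean` (this file imports `GrenetZeonDualUnipotentThreeHalvesLongMassLedgerBorelClosure`; the `UnipotentClosure` namespace is re-opened in
`…Closure.lean` with the same `open`s and `variable {ι} [Fintype ι] [DecidableEq ι] {K}` context), these headers, and one-line docstrings where the gate's
`lint.docstring` requires them.  `--supports stmt-ValiantsHypothesis-24318` helper.  ALL CREDIT: val-idea-28 g5.  HONEST STATUS (author's): INSTRUMENT — the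
normal form of (c)-certificates under a unipotent symmetry normalised by a torus; proves NO case of (c) `SlowCore.LongMassSlowLawInv`, NOT progress on
(c); 24318 OPEN; VP ≠ VNP is NOT proved.  The author's full module docstring is reproduced in `GrenetZeonDualUnipotentThreeHalvesLongMassLedgerBorelFamily.lean`.
-/

set_option linter.dupNamespace false

noncomputable section

/-! ## PART VIII (by name) — a `RelCert` / whole-pencil `Ledger` certificate of a pencil with a unipotent one-parameter symmetry
`exp(u·A)` may be taken `A`-STABLE (same order `k`, same finrank, same price). -/

namespace Summit.ValiantsHypothesis.ValiantsHypothesis.Theorems.GrenetZeon.InitialForm.LedgerUnipotent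

open Matrix
open Summit.ValiantsHypothesis.ValiantsHypothesis.Cruxes.TwoDimCoefficients.DimTwoCases (AffMat IsAffine)
open Summit.ValiantsHypothesis.ValiantsHypothesis.Theorems.GrenetZeon.RadicalSplit (lineSubst)
open Summit.ValiantsHypothesis.ValiantsHypothesis.Theorems.GrenetZeon.InitialForm.TorusClosure (TorusEquivariant map_eval_map_C)
open Summit.ValiantsHypothesis.ValiantsHypothesis.Theorems.GrenetZeon.InitialForm.SlowTorus (map_C_map_lineSubst conj_pow totalDegree_conj_le)
open Summit.ValiantsHypothesis.ValiantsHypothesis.Theorems.GrenetZeon.InitialForm.LedgerTorus (WindowCone ledger_top_iff_windowCone windowCone_torusAct windowFamily windowCone_iff_family)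
open Summit.ValiantsHypothesis.ValiantsHypothesis.Theorems.GrenetZeon.InitialForm.UnipotentClosure (exists_stable_of_expStable exists_graded_stable exp_smul_mul_exp_smul)
open Summit.ValiantsHypothesis.ValiantsHypothesis.Theorems.GrenetZeon.SlowCore (Ledger RelCert)

variable {n m : ℕ}

/-- The linear substitution `X_e ↦ ∑_{e'} G e e' · X_{e'}` of the coordinate ring. -/
def σ (G : Matrix (Fin n × Fin n) (Fin n × Fin n) ℂ) : MvPolynomial (Fin n × Fin n) ℂ →+* MvPolynomial (Fin n × Fin n) ℂ :=
  MvPolynomial.eval₂Hom MvPolynomial.C fun e => ∑ e', MvPolynomial.C (G e e') * MvPolynomial.X e'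

/-- `eval_comp_σ` — helper of this port (see the module docstring for its role). (docstring added in the port) -/
theorem eval_comp_σ (G : Matrix (Fin n × Fin n) (Fin n × Fin n) ℂ) (y : Fin n × Fin n → ℂ) :
    (MvPolynomial.eval y).comp (σ G) = MvPolynomial.eval (G *ᵥ y) := by
  apply MvPolynomial.ringHom_ext
  · intro c; simp [σ]
  · intro e; simp [σ, Matrix.mulVec, dotProduct]

/-- `lineSubst_comp_σ` — helper of this port (see the module docstring for its role). (docstring added in the port) -/
theorem lineSubst_comp_σ (G : Matrix (Fin n × Fin n) (Fin n × Fin n) ℂ) (x v : Fin n × Fin n → ℂ) :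
    (lineSubst x v : MvPolynomial (Fin n × Fin n) ℂ →+* MvPolynomial (Fin 1) ℂ).comp (σ G)
      = (lineSubst (G *ᵥ x) (G *ᵥ v) : MvPolynomial (Fin n × Fin n) ℂ →+* MvPolynomial (Fin 1) ℂ) := by
  apply MvPolynomial.ringHom_ext
  · intro c; simp [σ, lineSubst]
  · intro e
    simp only [σ, lineSubst, Matrix.mulVec, dotProduct, RingHom.coe_comp, RingHom.coe_coe, Function.comp_apply,
      MvPolynomial.eval₂Hom_X', map_sum, map_mul, MvPolynomial.algHom_C, MvPolynomial.aeval_X, MvPolynomial.algebraMap_eq,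
      Fin.sum_univ_one, mul_add, Finset.sum_add_distrib, Finset.sum_mul, mul_assoc]

/-- Point equivariance under `G` lifts to the polynomial identity `N.map (σ G) = (a • D) · N · D'`. -/
theorem map_σ_eq (N : AffMat n m) {G : Matrix (Fin n × Fin n) (Fin n × Fin n) ℂ} {a : ℂ} {D D' : Matrix (Fin m) (Fin m) ℂ}
    (hconj : ∀ x, N.map (MvPolynomial.eval (G *ᵥ x)) = a • (D * N.map (MvPolynomial.eval x) * D')) :
    N.map (σ G) = (a • D).map MvPolynomial.C * N * D'.map MvPolynomial.C := by
  have key : ∀ y : Fin n × Fin n → ℂ, (N.map (σ G)).map (MvPolynomial.eval y)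
      = ((a • D).map MvPolynomial.C * N * D'.map MvPolynomial.C).map (MvPolynomial.eval y) := by
    intro y
    have hc : (⇑(MvPolynomial.eval y) ∘ ⇑(σ G) : MvPolynomial (Fin n × Fin n) ℂ → ℂ)
        = ⇑(MvPolynomial.eval (G *ᵥ y)) := by
      have := congrArg DFunLike.coe (eval_comp_σ G y)
      simpa using this
    rw [Matrix.map_map, hc, hconj y, Matrix.map_mul, Matrix.map_mul, map_eval_map_C, map_eval_map_C, Matrix.smul_mul,
      Matrix.smul_mul]
  refine Matrix.ext fun i j => MvPolynomial.funext fun y => ?_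
  have := congrFun (congrFun (key y) i) j
  simpa only [Matrix.map_apply] using this

/-- The line polynomial at a `G`-moved direction is a constant conjugate (times a nonzero scalar) of the line polynomial at the
original direction over the `G`-moved base point. -/
theorem map_lineSubst_linAct (N : AffMat n m) {G : Matrix (Fin n × Fin n) (Fin n × Fin n) ℂ} {a : ℂ} {D D' : Matrix (Fin m) (Fin m) ℂ}
    (hconj : ∀ x, N.map (MvPolynomial.eval (G *ᵥ x)) = a • (D * N.map (MvPolynomial.eval x) * D'))
    (x v : Fin n × Fin n → ℂ) :
    N.map (lineSubst (G *ᵥ x) (G *ᵥ v))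
      = a • (D.map MvPolynomial.C * N.map (lineSubst x v) * D'.map MvPolynomial.C) := by
  have hc : (⇑(lineSubst x v) ∘ ⇑(σ G) : MvPolynomial (Fin n × Fin n) ℂ → MvPolynomial (Fin 1) ℂ)
      = ⇑(lineSubst (G *ᵥ x) (G *ᵥ v)) := by
    have := congrArg DFunLike.coe (lineSubst_comp_σ G x v)
    simpa using this
  have h1 : N.map (lineSubst (G *ᵥ x) (G *ᵥ v)) = (N.map (σ G)).map (lineSubst x v) := by
    rw [Matrix.map_map, hc]
  have h2 : ((a • D).map MvPolynomial.C * N * D'.map MvPolynomial.C).map (lineSubst x v)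
      = (a • D).map (MvPolynomial.C : ℂ → MvPolynomial (Fin 1) ℂ) * N.map (lineSubst x v)
          * D'.map (MvPolynomial.C : ℂ → MvPolynomial (Fin 1) ℂ) := by
    have e1 := map_mul (lineSubst x v).toRingHom.mapMatrix ((a • D).map MvPolynomial.C * N) (D'.map MvPolynomial.C)
    have e2 := map_mul (lineSubst x v).toRingHom.mapMatrix ((a • D).map MvPolynomial.C) N
    rw [e2] at e1
    simp only [RingHom.mapMatrix_apply] at e1
    have e1' : ((a • D).map MvPolynomial.C * N * D'.map MvPolynomial.C).map (lineSubst x v)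
        = ((a • D).map MvPolynomial.C).map (lineSubst x v) * N.map (lineSubst x v)
            * (D'.map MvPolynomial.C).map (lineSubst x v) := e1
    rw [e1', map_C_map_lineSubst, map_C_map_lineSubst]
  have h3 : (a • D).map (MvPolynomial.C : ℂ → MvPolynomial (Fin 1) ℂ) = a • D.map (MvPolynomial.C : ℂ → MvPolynomial (Fin 1) ℂ) := by
    ext i j : 1
    · simp [Matrix.map_apply, MvPolynomial.smul_eq_C_mul]
  rw [h1, map_σ_eq N hconj, h2, h3, Matrix.smul_mul, Matrix.smul_mul]

/-- Equivariance of an affine pencil under the linear change of coordinates `G` (up to a constant conjugation and a nonzero scalar),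
the linear analogue of `TorusEquivariant`. -/
def LinEquivariant (N : AffMat n m) (G : Matrix (Fin n × Fin n) (Fin n × Fin n) ℂ) : Prop :=
  ∃ (a : ℂ) (D D' : Matrix (Fin m) (Fin m) ℂ), a ≠ 0 ∧ D * D' = 1 ∧ D' * D = 1 ∧
    ∀ x, N.map (MvPolynomial.eval (G *ᵥ x)) = a • (D * N.map (MvPolynomial.eval x) * D')

/-- ★ The window cone is stable under every invertible linear symmetry of the pencil. -/
theorem windowCone_linAct (N : AffMat n m) {G G' : Matrix (Fin n × Fin n) (Fin n × Fin n) ℂ} (hG : LinEquivariant N G)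
    (hGG' : G * G' = 1) {k : ℕ} {v : Fin n × Fin n → ℂ} (hv : WindowCone N k v) : WindowCone N k (G *ᵥ v) := by
  intro x b hb i j
  obtain ⟨c, D, D', hc, -, hD'D, hconj⟩ := hG
  set x' := G' *ᵥ x with hx'
  have hx : x = G *ᵥ x' := by rw [hx', Matrix.mulVec_mulVec, hGG', Matrix.one_mulVec]
  rw [hx, map_lineSubst_linAct N hconj x' v, smul_pow]
  have hE'E : D'.map (MvPolynomial.C : ℂ → MvPolynomial (Fin 1) ℂ) * D.map MvPolynomial.C = 1 := by
    rw [← Matrix.map_mul, hD'D, Matrix.map_one MvPolynomial.C (map_zero _) (map_one _)]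
  rcases conj_pow (D.map MvPolynomial.C) (D'.map MvPolynomial.C) (N.map (lineSubst x' v)) hE'E b with h | h
  · rw [h]
    exact totalDegree_conj_le D D' (c ^ b) _ (fun i j => hv x' b hb i j) i j
  · rw [h, pow_zero, pow_zero, one_smul, Matrix.one_apply]
    split_ifs <;> simp

/-- ★★ **UNIPOTENT H_coord IN THE LEDGER CURRENCY.**  A whole-pencil ledger `(K, k)` of an affine pencil with the unipotent one-parameter
symmetry `u ↦ exp (u·A)` (`A` nilpotent on the coordinate space) may be taken `A`-STABLE: same `k`, same finrank, hence same PRICE. -/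
theorem ledger_stable_of_unipotentEquivariant (N : AffMat n m) (A : Matrix (Fin n × Fin n) (Fin n × Fin n) ℂ) (hA : IsNilpotent A)
    (hU : ∀ u : ℂ, LinEquivariant N (IsNilpotent.exp (u • A))) (K : Submodule ℂ (Fin n × Fin n → ℂ)) (k : ℕ)
    (hK : Ledger n m N (fun _ => True) K k) :
    ∃ K₀ : Submodule ℂ (Fin n × Fin n → ℂ), Module.finrank ℂ K₀ = Module.finrank ℂ K ∧
      (∀ v ∈ K₀, A *ᵥ v ∈ K₀) ∧ Ledger n m N (fun _ => True) K₀ k := by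
  rw [ledger_top_iff_windowCone] at hK
  have hstab : ∀ u : ℂ, ∀ v ∈ K, ∀ H ∈ windowFamily N k, MvPolynomial.eval (IsNilpotent.exp (u • A) *ᵥ v) H = 0 := by
    intro u v hv
    rw [← windowCone_iff_family]
    have h1 : IsNilpotent.exp (u • A) * IsNilpotent.exp ((-u) • A) = 1 := by
      rw [exp_smul_mul_exp_smul hA, add_neg_cancel, zero_smul, IsNilpotent.exp_zero]
    exact windowCone_linAct N (hU u) h1 (hK v hv)
  obtain ⟨K₀, hdim, hst, hZ⟩ := exists_stable_of_expStable A hA K (windowFamily N k) hstab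
  refine ⟨K₀, hdim, hst, ?_⟩
  rw [ledger_top_iff_windowCone]
  exact fun v hv => (windowCone_iff_family N k v).mpr (hZ v hv)

/-- ★★ **`RelCert` certificates may be taken stable under a unipotent symmetry of the pencil** (by name, vs `SlowCore.RelCert`). -/
theorem relCert_stable_of_unipotentEquivariant (N : AffMat n m) (A : Matrix (Fin n × Fin n) (Fin n × Fin n) ℂ) (hA : IsNilpotent A)
    (hU : ∀ u : ℂ, LinEquivariant N (IsNilpotent.exp (u • A))) {P : ℕ} (h : RelCert n m N P) :
    ∃ (K : Submodule ℂ (Fin n × Fin n → ℂ)) (k : ℕ), (∀ v ∈ K, A *ᵥ v ∈ K) ∧ Ledger n m N (fun _ => True) K k ∧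
      n * k + (n * n - Module.finrank ℂ K) ≤ P := by
  obtain ⟨K, k, hK, hprice⟩ := h
  obtain ⟨K₀, hdim, hst, hK₀⟩ := ledger_stable_of_unipotentEquivariant N A hA hU K k hK
  exact ⟨K₀, k, hst, hK₀, by rwa [hdim]⟩


/-- ★★ **BOREL NORMAL FORM IN THE LEDGER CURRENCY.**  For an affine pencil equivariant under a torus `λ_w` AND under a unipotent one-parameter group
`exp(u·A)` normalised by the torus (`λ_w(τ) A = c_τ A λ_w(τ)`, `c_τ ≠ 0`), a whole-pencil ledger `(K, k)` may be taken WEIGHT-GRADED AND `A`-STABLE, same `k`,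
same finrank (hence same price). -/
theorem ledger_borel_of_equivariant (N : AffMat n m) (w : Fin n × Fin n → ℕ) (hT : TorusEquivariant N w)
    (A : Matrix (Fin n × Fin n) (Fin n × Fin n) ℂ) (hA : IsNilpotent A) (hU : ∀ u : ℂ, LinEquivariant N (IsNilpotent.exp (u • A)))
    (hcomp : ∀ τ : ℂ, τ ≠ 0 → ∃ c : ℂ, c ≠ 0 ∧
      (Matrix.diagonal fun e => τ ^ w e) * A = c • (A * Matrix.diagonal fun e => τ ^ w e))
    (K : Submodule ℂ (Fin n × Fin n → ℂ)) (k : ℕ) (hK : Ledger n m N (fun _ => True) K k) :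
    ∃ K₀ : Submodule ℂ (Fin n × Fin n → ℂ), Module.finrank ℂ K₀ = Module.finrank ℂ K ∧ (∀ s ∈ K₀, ∀ c, wtProj w c s ∈ K₀) ∧
      (∀ v ∈ K₀, A *ᵥ v ∈ K₀) ∧ Ledger n m N (fun _ => True) K₀ k := by
  rw [ledger_top_iff_windowCone] at hK
  have hZT : ∀ τ : ℂ, τ ≠ 0 → ∀ v : Fin n × Fin n → ℂ, (∀ H ∈ windowFamily N k, MvPolynomial.eval v H = 0) →
      ∀ H ∈ windowFamily N k, MvPolynomial.eval (torusAct w τ v) H = 0 := by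
    intro τ hτ v hv
    rw [← windowCone_iff_family] at hv ⊢
    exact windowCone_torusAct N hT hv hτ
  have hZU : ∀ (u : ℂ) (v : Fin n × Fin n → ℂ), (∀ H ∈ windowFamily N k, MvPolynomial.eval v H = 0) →
      ∀ H ∈ windowFamily N k, MvPolynomial.eval (IsNilpotent.exp (u • A) *ᵥ v) H = 0 := by
    intro u v hv
    rw [← windowCone_iff_family] at hv ⊢
    have h1 : IsNilpotent.exp (u • A) * IsNilpotent.exp ((-u) • A) = 1 := by
      rw [exp_smul_mul_exp_smul hA, add_neg_cancel, zero_smul, IsNilpotent.exp_zero]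
    exact windowCone_linAct N (hU u) h1 hv
  obtain ⟨K₀, hdim, hgr, hst, hZ⟩ := exists_graded_stable w A hA hcomp (windowFamily N k) hZT hZU K
    (fun v hv => (windowCone_iff_family N k v).mp (hK v hv))
  refine ⟨K₀, hdim, hgr, hst, ?_⟩
  rw [ledger_top_iff_windowCone]
  exact fun v hv => (windowCone_iff_family N k v).mpr (hZ v hv)

/-- ★★ **`RelCert` certificates in BOREL NORMAL FORM** (by name, vs `SlowCore.RelCert`): weight-graded and `A`-stable, same price. -/
theorem relCert_borel_of_equivariant (N : AffMat n m) (w : Fin n × Fin n → ℕ) (hT : TorusEquivariant N w)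
    (A : Matrix (Fin n × Fin n) (Fin n × Fin n) ℂ) (hA : IsNilpotent A) (hU : ∀ u : ℂ, LinEquivariant N (IsNilpotent.exp (u • A)))
    (hcomp : ∀ τ : ℂ, τ ≠ 0 → ∃ c : ℂ, c ≠ 0 ∧
      (Matrix.diagonal fun e => τ ^ w e) * A = c • (A * Matrix.diagonal fun e => τ ^ w e))
    {P : ℕ} (h : RelCert n m N P) :
    ∃ (K : Submodule ℂ (Fin n × Fin n → ℂ)) (k : ℕ), (∀ s ∈ K, ∀ c, wtProj w c s ∈ K) ∧ (∀ v ∈ K, A *ᵥ v ∈ K) ∧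
      Ledger n m N (fun _ => True) K k ∧ n * k + (n * n - Module.finrank ℂ K) ≤ P := by
  obtain ⟨K, k, hK, hprice⟩ := h
  obtain ⟨K₀, hdim, hgr, hst, hK₀⟩ := ledger_borel_of_equivariant N w hT A hA hU hcomp K k hK
  exact ⟨K₀, k, hgr, hst, hK₀, by rwa [hdim]⟩

end Summit.ValiantsHypothesis.ValiantsHypothesis.Theorems.GrenetZeon.InitialForm.LedgerUnipotent

end
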